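import Literature.Computability.Complexity.Circuit
import Literature.LinearAlgebra.Matrix.RankMinors
import Mathlib.Algebra.MvPolynomial.CommRing
import Mathlib.Algebra.Order.BigOperators.Group.Finset
import Mathlib.Data.Real.Basic
import Mathlib.GroupTheory.Perm.Basic
import Mathlib.Algebra.Group.Subgroup.Lattice
import Mathlib.LinearAlgebra.Matrix.PosDef
import Mathlib.LinearAlgebra.Matrix.Trace
import Mathlib.RingTheory.Localization.FractionRing
import Mathlib.Tactic.Linarith
import HarnessLib

/-!
# Extended monotone gates: SDP-feasibility (CONV), permutation (PERM), generic rank (GRANK)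

Three classes of *wide monotone gates* over the gate type `GateFn = Σ k, (Fin k → Bool) → Bool`
of `Literature/Computability/Complexity/Circuit.lean`, each with a size parameter `s : ℕ`, and
the *extended monotone basis* `extGate s = {∧₂, ∨₂} ∪ CONV_s ∪ PERM_s ∪ GRANK_s`. They are the
gate classes that route `PneNP/ConvexRankGates` inlines as `let`s in every item; this file names
them (texts unchanged) and proves the bookkeeping facts the route's assembly uses.

* `IsConvGate s g` (CONV): `g` accepts `v` iff the semidefinite system
  `∃ Y ⪰ 0, ∀ i, tr (Aᵢ Y) ≤ bᵢ + ∑ⱼ Bᵢⱼ [vⱼ]` is FEASIBLE, where `B ≥ 0` entrywise and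
  `#constraints + dim Y ≤ s`. Restricting `Y` to diagonal matrices gives LP feasibility of
  `{x ≥ 0 | A x ≤ b + B v}`, i.e. the domain of definition of a *max-right weak MLP gate*
  `ℓ(y) = max {c·x | A x ≤ b + B y, x ≥ 0}` of Oliveira–Pudlák (2019, Def. 3.1: "the requirement
  that `B ≥ 0` and `C ≥ 0` guarantees that the gates introduced above are monotone"; size = rows +
  columns of `A`; also Krajíček 2019, §18.8). The SDP (rather than LP) form and the feasibility
  (rather than sign-of-optimum, OP19 Def. 3.2) acceptance condition are the requesting route's
  choice; we record them as filed.
* `IsPermGate s g` (PERM): fixed permutations `σᵢ, τ` of `≤ s` points; `g` accepts `v` iff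
  `τ ∈ ⟨σᵢ : vᵢ = 1⟩` — the membership problem for permutation groups given by generators,
  decidable in polynomial time (Furst–Hopcroft–Luks 1980, §1 and Thm. 1, after Sims). Its abelian
  shadow is the monotone span program `f(u) = 1 ↔ 1 ∈ Span A(u)` (Karchmer–Wigderson; Krajíček
  2019, §18.3: "clearly, a monotone span program computes a monotone Boolean function").
* `IsGRankGate s g` (GRANK): matrices `K₀, Kᵢ ∈ F^{d×d}` over a field `F`, `d ≤ s`, threshold
  `θ`; `g` accepts `v` iff the *generic rank* — the rank over `Frac (F[X₁,…,Xₙ])` of the symbolic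
  matrix `K₀ + ∑_{vᵢ = 1} Xᵢ Kᵢ` (`symbolicMatrix K₀ K v`) — is at least `θ` (Edmonds 1967, §5
  Thm. 1: term rank = rank of the matrix of distinct indeterminates; §7, p. 244: the rank of
  matrices with polynomial entries; Tutte 1947 for general matching).

API (all proved): monotonicity in the size parameter (`IsConvGate.mono`, …, `extGate_mono`);
every extended gate computes a MONOTONE Boolean function (`IsConvGate.monotone` since `B ≥ 0`,
`IsPermGate.monotone` since `Subgroup.closure` is monotone, `IsGRankGate.monotone` since
specialising `Xᵢ := 0` cannot create a non-zero minor — `symbolicMatrix_rank_mono`, via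
`Literature/LinearAlgebra/Matrix/RankMinors.lean`; `extGate_monotone`); and non-vacuity of CONV:
every threshold gate `Tₜᵏ`, hence `∧ₖ`, `∨ₖ`, `MAJₖ`, is a CONV gate of size `1` with `dim Y = 0`
(`thr_isConvGate`, `and_isConvGate`, `or_isConvGate`, `maj_isConvGate`).

Design notes. `F : Type` (universe `0`) in `IsGRankGate` and the indicator
`if v j then (1 : ℝ) else 0`, literally as filed. No complexity claims about the gates themselves
are made (exact SDP feasibility, field constants of unbounded bit size: the route's model is
non-uniform by design). NOT here: lower bounds, the route's Lovász-theta / Edmonds-matrix /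
XOR-SAT sanity items, and Oliveira–Pudlák's optimisation-form MLP gates and MLP circuits.
-/

noncomputable section

namespace Literature.Computability.Complexity

open Finset Matrix

/-! ### The three gate classes and the extended basis -/

/-- **CONV gates** (monotone SDP-feasibility gates of size `≤ s`). `IsConvGate s g` says: there
are `p` constraints and a `q × q` matrix variable with `p + q ≤ s`, real data `Aᵢ ∈ ℝ^{q×q}`,
`bᵢ ∈ ℝ`, and an entrywise non-negative `B ∈ ℝ^{p×k}` (`k` the arity of `g`) such that for every
input `v`, `g v = 1 ↔ ∃ Y ⪰ 0, ∀ i, tr (Aᵢ Y) ≤ bᵢ + ∑ⱼ Bᵢⱼ [vⱼ]`. The diagonal-`Y` case is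
feasibility of the constraint system `A x ≤ b + B y, x ≥ 0` (`B ≥ 0`) of a max-right weak MLP
gate, Oliveira–Pudlák 2019, Def. 3.1 (whose size is likewise rows + columns); the SDP-feasibility
form is the one filed by route PneNP/ConvexRankGates. [cite: OliveiraPudlak2019, Def. 3.1] -/
def IsConvGate (s : ℕ) (g : GateFn) : Prop :=
  ∃ p q : ℕ, p + q ≤ s ∧ ∃ (A : Fin p → Matrix (Fin q) (Fin q) ℝ) (b : Fin p → ℝ)
    (B : Fin p → Fin g.1 → ℝ), (∀ i j, 0 ≤ B i j) ∧ ∀ v : Fin g.1 → Bool, g.2 v = true ↔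
      ∃ Y : Matrix (Fin q) (Fin q) ℝ, Y.PosSemidef ∧
        ∀ i, (A i * Y).trace ≤ b i + ∑ j, B i j * (if v j then (1 : ℝ) else 0)

/-- **PERM gates** (permutation-group membership gates on `≤ s` points). `IsPermGate s g` says:
there are `d ≤ s`, permutations `σᵢ ∈ Sym (Fin d)` (one per input) and a target `τ ∈ Sym (Fin d)`
such that `g v = 1 ↔ τ` lies in the subgroup generated by `{σᵢ | vᵢ = 1}`. Membership in a
permutation group given by generators is the problem solved in polynomial time by
Furst–Hopcroft–Luks 1980 (§1; Thm. 1, strong generators after Sims); the abelian case is the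
monotone span-program acceptance condition `1 ∈ Span A(u)` (Krajíček 2019, §18.3).
[cite: FurstHopcroftLuks1980, §1 and Thm. 1] -/
def IsPermGate (s : ℕ) (g : GateFn) : Prop :=
  ∃ d : ℕ, d ≤ s ∧ ∃ (σ : Fin g.1 → Equiv.Perm (Fin d)) (τ : Equiv.Perm (Fin d)),
    ∀ v : Fin g.1 → Bool, g.2 v = true ↔ τ ∈ Subgroup.closure (σ '' {i | v i = true})

section GRank

variable {F : Type*} [Field F] {n d : ℕ}

/-- The **symbolic matrix** of the data `K₀, K₁, …, Kₙ ∈ F^{d×d}` at the input `v ∈ {0,1}ⁿ`: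
`K₀ + ∑_{i : vᵢ = 1} Xᵢ Kᵢ`, viewed over the field `Frac (F[X₁, …, Xₙ])`, so that `Matrix.rank` is
its generic rank (Edmonds 1967, §5 Thm. 1 and §7: "the rank of any matrix whose entries are
polynomials … in any number of indeterminates"). Written literally as in route
PneNP/ConvexRankGates. [cite: Edmonds1967, §5 Thm. 1 and §7] -/
def symbolicMatrix (K₀ : Matrix (Fin d) (Fin d) F) (K : Fin n → Matrix (Fin d) (Fin d) F)
    (v : Fin n → Bool) : Matrix (Fin d) (Fin d) (FractionRing (MvPolynomial (Fin n) F)) :=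
  K₀.map (algebraMap F (FractionRing (MvPolynomial (Fin n) F))) +
    ∑ i, if v i then
      (algebraMap (MvPolynomial (Fin n) F) (FractionRing (MvPolynomial (Fin n) F))
        (MvPolynomial.X i)) • (K i).map (algebraMap F (FractionRing (MvPolynomial (Fin n) F)))
      else 0

end GRank

/-- **GRANK gates** (generic-rank threshold gates of dimension `≤ s`). `IsGRankGate s g` says:
there are a field `F`, `d ≤ s`, a threshold `θ` and matrices `K₀, Kᵢ ∈ F^{d×d}` (one `Kᵢ` per
input) such that `g v = 1 ↔ θ ≤ rank_{Frac F[X]} (K₀ + ∑_{vᵢ = 1} Xᵢ Kᵢ)` (`symbolicMatrix`).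
With `K₀ = 0`, `K_{(a,b)} = E_{ab}`, `θ = d` this is Edmonds' criterion for a perfect matching in
a bipartite graph (Edmonds 1967, §5 Thm. 1; Tutte 1947 for the skew-symmetric version).
[cite: Edmonds1967, §5 Thm. 1 and §7] -/
def IsGRankGate (s : ℕ) (g : GateFn) : Prop :=
  ∃ (F : Type) (_ : Field F) (d θ : ℕ), d ≤ s ∧ ∃ (K₀ : Matrix (Fin d) (Fin d) F)
    (K : Fin g.1 → Matrix (Fin d) (Fin d) F),
      ∀ v : Fin g.1 → Bool, g.2 v = true ↔ θ ≤ (symbolicMatrix K₀ K v).rank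

/-- The **extended monotone basis** `B_s = {∧₂, ∨₂} ∪ CONV_s ∪ PERM_s ∪ GRANK_s` of route
PneNP/ConvexRankGates: the monotone basis `{∧₂, ∨₂}` (Jukna 2012, §1.2) together with all CONV,
PERM and GRANK gates of size parameter `≤ s`. [cite: Jukna2012, §1.2] -/
def extGate (s : ℕ) : Set GateFn :=
  {GateFn.and 2, GateFn.or 2} ∪ {g | IsConvGate s g ∨ IsPermGate s g ∨ IsGRankGate s g}

/-! ### Membership and monotonicity in the size parameter -/

/-- Membership in `extGate s`, spelled out as a flat disjunction. [folklore] -/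
theorem mem_extGate_iff {s : ℕ} {g : GateFn} : g ∈ extGate s ↔
    g = GateFn.and 2 ∨ g = GateFn.or 2 ∨ IsConvGate s g ∨ IsPermGate s g ∨ IsGRankGate s g := by
  simp only [extGate, Set.mem_union, Set.mem_insert_iff, Set.mem_singleton_iff, Set.mem_setOf_eq,
    or_assoc]

/-- `{∧₂, ∨₂} ⊆ B_s`. [folklore] -/
theorem monotoneBasis_subset_extGate (s : ℕ) : monotoneBasis ⊆ extGate s :=
  Set.subset_union_left

/-- `∧₂ ∈ B_s`. [folklore] -/
theorem and_mem_extGate (s : ℕ) : GateFn.and 2 ∈ extGate s :=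
  mem_extGate_iff.2 (Or.inl rfl)

/-- `∨₂ ∈ B_s`. [folklore] -/
theorem or_mem_extGate (s : ℕ) : GateFn.or 2 ∈ extGate s :=
  mem_extGate_iff.2 (Or.inr (Or.inl rfl))

/-- CONV gates are extended gates. [folklore] -/
theorem IsConvGate.mem_extGate {s : ℕ} {g : GateFn} (h : IsConvGate s g) : g ∈ extGate s :=
  mem_extGate_iff.2 (Or.inr (Or.inr (Or.inl h)))

/-- PERM gates are extended gates. [folklore] -/
theorem IsPermGate.mem_extGate {s : ℕ} {g : GateFn} (h : IsPermGate s g) : g ∈ extGate s :=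
  mem_extGate_iff.2 (Or.inr (Or.inr (Or.inr (Or.inl h))))

/-- GRANK gates are extended gates. [folklore] -/
theorem IsGRankGate.mem_extGate {s : ℕ} {g : GateFn} (h : IsGRankGate s g) : g ∈ extGate s :=
  mem_extGate_iff.2 (Or.inr (Or.inr (Or.inr (Or.inr h))))

/-- CONV_s ⊆ CONV_t for `s ≤ t`. [folklore] -/
theorem IsConvGate.mono {s t : ℕ} {g : GateFn} (h : IsConvGate s g) (hst : s ≤ t) :
    IsConvGate t g := by
  obtain ⟨p, q, hpq, hrest⟩ := h
  exact ⟨p, q, hpq.trans hst, hrest⟩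

/-- PERM_s ⊆ PERM_t for `s ≤ t`. [folklore] -/
theorem IsPermGate.mono {s t : ℕ} {g : GateFn} (h : IsPermGate s g) (hst : s ≤ t) :
    IsPermGate t g := by
  obtain ⟨d, hd, hrest⟩ := h
  exact ⟨d, hd.trans hst, hrest⟩

/-- GRANK_s ⊆ GRANK_t for `s ≤ t`. [folklore] -/
theorem IsGRankGate.mono {s t : ℕ} {g : GateFn} (h : IsGRankGate s g) (hst : s ≤ t) :
    IsGRankGate t g := by
  obtain ⟨F, hF, d, θ, hd, hrest⟩ := h
  exact ⟨F, hF, d, θ, hd.trans hst, hrest⟩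

/-- The extended basis grows with the size parameter: `B_s ⊆ B_t` for `s ≤ t` (used by the
route's assembly to absorb `(m^c + |E(K_m)| + 2)^a ≤ m^{c'}`). [folklore] -/
theorem extGate_mono {s t : ℕ} (hst : s ≤ t) : extGate s ⊆ extGate t := by
  intro g hg
  rw [mem_extGate_iff] at hg ⊢
  rcases hg with h | h | h | h | h
  · exact Or.inl h
  · exact Or.inr (Or.inl h)
  · exact Or.inr (Or.inr (Or.inl (h.mono hst)))
  · exact Or.inr (Or.inr (Or.inr (Or.inl (h.mono hst))))
  · exact Or.inr (Or.inr (Or.inr (Or.inr (h.mono hst))))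

/-! ### Every extended gate computes a monotone Boolean function -/

/-- In `Bool`, `a ≤ b` and `a = true` force `b = true`. [folklore] -/
theorem eq_true_of_le_of_eq_true {a b : Bool} (h : a ≤ b) (ha : a = true) : b = true := by
  subst ha; revert h; cases b <;> decide

/-- A Boolean function given by an acceptance predicate `P` that is upward closed is monotone.
[folklore] -/
theorem monotone_of_forall_iff {k : ℕ} {f : (Fin k → Bool) → Bool} {P : (Fin k → Bool) → Prop}
    (hf : ∀ v, f v = true ↔ P v) (hP : ∀ ⦃v w : Fin k → Bool⦄, v ≤ w → P v → P w) :
    Monotone f := by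
  intro v w hvw
  cases hv : f v with
  | false => exact Bool.false_le _
  | true =>
    have hw : f w = true := (hf w).2 (hP hvw ((hf v).1 hv))
    rw [hw]

/-- The real indicator `[vⱼ]` is monotone in `v`. [folklore] -/
theorem indicator_le_indicator {k : ℕ} {v w : Fin k → Bool} (h : v ≤ w) (j : Fin k) :
    (if v j then (1 : ℝ) else 0) ≤ (if w j then (1 : ℝ) else 0) := by
  by_cases hv : v j = true
  · rw [if_pos hv, if_pos (eq_true_of_le_of_eq_true (h j) hv)]
  · rw [if_neg hv]
    split_ifs <;> norm_num

/-- `∧ₖ` is monotone. [folklore] -/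
theorem GateFn.and_monotone (k : ℕ) : Monotone (GateFn.and k).2 :=
  monotone_of_forall_iff (P := fun v => ∀ i, v i = true) (fun _ => decide_eq_true_iff)
    fun _ _ hvw hv i => eq_true_of_le_of_eq_true (hvw i) (hv i)

/-- `∨ₖ` is monotone. [folklore] -/
theorem GateFn.or_monotone (k : ℕ) : Monotone (GateFn.or k).2 :=
  monotone_of_forall_iff (P := fun v => ∃ i, v i = true) (fun _ => decide_eq_true_iff)
    fun _ _ hvw ⟨i, hi⟩ => ⟨i, eq_true_of_le_of_eq_true (hvw i) hi⟩

/-- **CONV gates are monotone**: a feasible `Y` for `v` stays feasible for `w ≥ v` because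
`B ≥ 0` only relaxes the right-hand sides (Oliveira–Pudlák 2019, remark after Def. 3.1).
[cite: OliveiraPudlak2019, Def. 3.1] -/
theorem IsConvGate.monotone {s : ℕ} {g : GateFn} (h : IsConvGate s g) : Monotone g.2 := by
  obtain ⟨p, q, -, A, b, B, hB, hg⟩ := h
  refine monotone_of_forall_iff hg fun v w hvw ⟨Y, hY, hc⟩ => ⟨Y, hY, fun i => (hc i).trans ?_⟩
  exact add_le_add le_rfl (Finset.sum_le_sum fun j _ =>
    mul_le_mul_of_nonneg_left (indicator_le_indicator hvw j) (hB i j))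

/-- **PERM gates are monotone**: enlarging the set of selected generators enlarges the generated
subgroup. [folklore] -/
theorem IsPermGate.monotone {s : ℕ} {g : GateFn} (h : IsPermGate s g) : Monotone g.2 := by
  obtain ⟨d, -, σ, τ, hg⟩ := h
  exact monotone_of_forall_iff hg fun v w hvw hv =>
    Subgroup.closure_mono (Set.image_mono fun i hi => eq_true_of_le_of_eq_true (hvw i) hi) hv

section GRank

variable {F : Type*} [Field F] {n d : ℕ}

/-- The substitution `Xᵢ ↦ Xᵢ` if `vᵢ = 1`, `Xᵢ ↦ 0` otherwise (an `F`-algebra endomorphism of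
`F[X₁, …, Xₙ]`). [folklore] -/
def killVars (v : Fin n → Bool) : MvPolynomial (Fin n) F →ₐ[F] MvPolynomial (Fin n) F :=
  MvPolynomial.aeval fun i => if v i then MvPolynomial.X i else 0

/-- `killVars v` on a variable. [folklore] -/
@[simp]
theorem killVars_X (v : Fin n → Bool) (i : Fin n) :
    killVars v (MvPolynomial.X i : MvPolynomial (Fin n) F) =
      if v i then MvPolynomial.X i else 0 := by
  simp [killVars]

/-- Killing the variables outside `w ⊇ v` and then those outside `v` is killing those outside
`v`. [folklore] -/
theorem killVars_comp {v w : Fin n → Bool} (hvw : v ≤ w) :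
    (killVars v).comp (killVars w) = killVars (F := F) v := by
  refine MvPolynomial.algHom_ext fun i => ?_
  simp only [AlgHom.comp_apply, killVars_X]
  by_cases hw : w i = true
  · simp [hw]
  · cases hv : v i with
    | true => exact absurd (eq_true_of_le_of_eq_true (hvw i) hv) hw
    | false => simp [hw]

/-- The **generic symbolic matrix** `K₀ + ∑ᵢ Xᵢ Kᵢ` with polynomial entries. [folklore] -/
def symbolicPolyMatrix (K₀ : Matrix (Fin d) (Fin d) F) (K : Fin n → Matrix (Fin d) (Fin d) F) :
    Matrix (Fin d) (Fin d) (MvPolynomial (Fin n) F) :=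
  K₀.map (MvPolynomial.C : F →+* MvPolynomial (Fin n) F) +
    ∑ i, (MvPolynomial.X i : MvPolynomial (Fin n) F) •
      (K i).map (MvPolynomial.C : F →+* MvPolynomial (Fin n) F)

/-- `symbolicMatrix K₀ K v` is the generic symbolic matrix with the unselected variables killed,
pushed into the fraction field. [folklore] -/
theorem symbolicMatrix_eq_map (K₀ : Matrix (Fin d) (Fin d) F) (K : Fin n → Matrix (Fin d) (Fin d) F)
    (v : Fin n → Bool) :
    symbolicMatrix K₀ K v = ((symbolicPolyMatrix K₀ K).map (killVars v)).map
      (algebraMap (MvPolynomial (Fin n) F) (FractionRing (MvPolynomial (Fin n) F))) := by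
  ext a b
  simp only [symbolicMatrix, symbolicPolyMatrix, Matrix.add_apply, Matrix.map_apply,
    Matrix.sum_apply, ← ite_zero_smul, Matrix.smul_apply, smul_eq_mul, map_add, map_sum, map_mul,
    MvPolynomial.algHom_C, killVars_X, apply_ite, map_zero, zero_mul, ite_mul,
    IsScalarTower.algebraMap_apply F (MvPolynomial (Fin n) F)
      (FractionRing (MvPolynomial (Fin n) F)), MvPolynomial.algebraMap_eq]

/-- Minors of `symbolicMatrix K₀ K v` are the images of the killed minors of the generic symbolic
matrix. [folklore] -/
theorem det_submatrix_symbolicMatrix (K₀ : Matrix (Fin d) (Fin d) F)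
    (K : Fin n → Matrix (Fin d) (Fin d) F) (v : Fin n → Bool) {ι : Type*} [Fintype ι]
    [DecidableEq ι] (r c : ι → Fin d) :
    ((symbolicMatrix K₀ K v).submatrix r c).det =
      algebraMap (MvPolynomial (Fin n) F) (FractionRing (MvPolynomial (Fin n) F))
        (killVars v ((symbolicPolyMatrix K₀ K).submatrix r c).det) := by
  rw [symbolicMatrix_eq_map, Matrix.submatrix_map, Matrix.submatrix_map, AlgHom.map_det,
    AlgHom.mapMatrix_apply, RingHom.map_det, RingHom.mapMatrix_apply]

/-- A minor of `symbolicMatrix K₀ K v` vanishes iff the corresponding killed generic minor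
vanishes (the map to the fraction field is injective). [folklore] -/
theorem det_submatrix_symbolicMatrix_eq_zero_iff (K₀ : Matrix (Fin d) (Fin d) F)
    (K : Fin n → Matrix (Fin d) (Fin d) F) (v : Fin n → Bool) {ι : Type*} [Fintype ι]
    [DecidableEq ι] (r c : ι → Fin d) :
    ((symbolicMatrix K₀ K v).submatrix r c).det = 0 ↔
      killVars v ((symbolicPolyMatrix K₀ K).submatrix r c).det = 0 := by
  rw [det_submatrix_symbolicMatrix, map_eq_zero_iff _ (IsFractionRing.injective
    (MvPolynomial (Fin n) F) (FractionRing (MvPolynomial (Fin n) F)))]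

/-- **Specialising variables to `0` only lowers the generic rank**: for `v ≤ w`,
`rank (K₀ + ∑_{vᵢ=1} Xᵢ Kᵢ) ≤ rank (K₀ + ∑_{wᵢ=1} Xᵢ Kᵢ)` over `Frac F[X]` — a non-zero `r × r`
minor of the specialisation is the specialisation of the same minor, which is therefore non-zero
(Edmonds 1967, proof of Thm. 1: "the linear-algebra rank of a matrix equals the maximum order of
a minor with nonzero determinant"). [cite: Edmonds1967, §5 Thm. 1 and §7] -/
theorem symbolicMatrix_rank_mono (K₀ : Matrix (Fin d) (Fin d) F)
    (K : Fin n → Matrix (Fin d) (Fin d) F) {v w : Fin n → Bool} (hvw : v ≤ w) :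
    (symbolicMatrix K₀ K v).rank ≤ (symbolicMatrix K₀ K w).rank := by
  obtain ⟨r, c, hne⟩ := (Literature.LinearAlgebra.Matrix.le_rank_iff_exists_det_submatrix_ne_zero
    (symbolicMatrix K₀ K v)).1 le_rfl
  refine (Literature.LinearAlgebra.Matrix.le_rank_iff_exists_det_submatrix_ne_zero
    (symbolicMatrix K₀ K w)).2 ⟨r, c, fun h0 => hne ?_⟩
  rw [det_submatrix_symbolicMatrix_eq_zero_iff] at h0 ⊢
  rw [← killVars_comp hvw, AlgHom.comp_apply, h0, map_zero]

end GRank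

/-- **GRANK gates are monotone**: specialising `Xᵢ := 0` only lowers the generic rank
(`symbolicMatrix_rank_mono`). [cite: Edmonds1967, §5 Thm. 1 and §7] -/
theorem IsGRankGate.monotone {s : ℕ} {g : GateFn} (h : IsGRankGate s g) : Monotone g.2 := by
  obtain ⟨F, _, d, θ, -, K₀, K, hg⟩ := h
  exact monotone_of_forall_iff hg fun v w hvw hv => hv.trans (symbolicMatrix_rank_mono K₀ K hvw)

/-- **Every gate of the extended monotone basis computes a monotone Boolean function.**
[folklore] -/
theorem extGate_monotone {s : ℕ} {g : GateFn} (h : g ∈ extGate s) : Monotone g.2 := by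
  rw [mem_extGate_iff] at h
  rcases h with rfl | rfl | h | h | h
  · exact GateFn.and_monotone 2
  · exact GateFn.or_monotone 2
  · exact h.monotone
  · exact h.monotone
  · exact h.monotone

/-! ### Threshold gates are CONV gates of size one -/

/-- `∑ⱼ [vⱼ] = #ones(v)` in `ℝ`. [folklore] -/
theorem sum_indicator_eq_numOnes {k : ℕ} (v : Fin k → Bool) :
    (∑ j, (if v j then (1 : ℝ) else 0)) = (GateFn.numOnes v : ℝ) := by
  simp [GateFn.numOnes, Finset.sum_boole]

/-- `k ≤ #ones(v)` iff all inputs are `1`. [folklore] -/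
theorem GateFn.le_numOnes_iff {k : ℕ} (v : Fin k → Bool) :
    k ≤ GateFn.numOnes v ↔ ∀ i, v i = true := by
  have h := Finset.card_lt_iff_ne_univ (univ.filter fun i : Fin k => v i = true)
  rw [Fintype.card_fin] at h
  rw [GateFn.numOnes, ← not_lt, h, not_ne_iff, Finset.eq_univ_iff_forall]
  simp

/-- `1 ≤ #ones(v)` iff some input is `1`. [folklore] -/
theorem GateFn.one_le_numOnes_iff {k : ℕ} (v : Fin k → Bool) :
    1 ≤ GateFn.numOnes v ↔ ∃ i, v i = true := by
  rw [GateFn.numOnes, Nat.succ_le_iff, Finset.card_pos, Finset.filter_nonempty_iff]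
  simp

/-- A gate accepting exactly the inputs with at least `t` ones is a CONV gate with ONE linear
constraint and no matrix variable (`p = 1`, `q = 0`): `0 ≤ -t + ∑ⱼ [vⱼ]`. [folklore] -/
theorem isConvGate_one_of_threshold {k t : ℕ} {f : (Fin k → Bool) → Bool}
    (hf : ∀ v, f v = true ↔ t ≤ GateFn.numOnes v) : IsConvGate 1 ⟨k, f⟩ := by
  refine ⟨1, 0, le_rfl, fun _ => 0, fun _ => -(t : ℝ), fun _ _ => 1, fun _ _ => zero_le_one,
    fun v => ?_⟩
  show f v = true ↔ _
  rw [hf v]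
  constructor
  · intro ht
    refine ⟨0, Matrix.PosSemidef.zero, fun _ => ?_⟩
    have ht' : (t : ℝ) ≤ GateFn.numOnes v := by exact_mod_cast ht
    simp only [Matrix.zero_mul, Matrix.trace_zero, one_mul, sum_indicator_eq_numOnes]
    linarith
  · rintro ⟨Y, -, hY⟩
    have h0 := hY 0
    simp only [Matrix.zero_mul, Matrix.trace_zero, one_mul, sum_indicator_eq_numOnes] at h0
    exact_mod_cast (show (t : ℝ) ≤ GateFn.numOnes v by linarith)

/-- **Threshold gates are CONV gates**: `Tₜᵏ ∈ CONV₁`. [folklore] -/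
theorem thr_isConvGate (k t : ℕ) : IsConvGate 1 (GateFn.thr k t) :=
  isConvGate_one_of_threshold fun _ => decide_eq_true_iff

/-- `∧ₖ ∈ CONV₁` (as `∧ₖ = Tₖᵏ`). [folklore] -/
theorem and_isConvGate (k : ℕ) : IsConvGate 1 (GateFn.and k) :=
  isConvGate_one_of_threshold fun v => decide_eq_true_iff.trans (GateFn.le_numOnes_iff v).symm

/-- `∨ₖ ∈ CONV₁` (as `∨ₖ = T₁ᵏ`). [folklore] -/
theorem or_isConvGate (k : ℕ) : IsConvGate 1 (GateFn.or k) :=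
  isConvGate_one_of_threshold fun v => decide_eq_true_iff.trans (GateFn.one_le_numOnes_iff v).symm

/-- `MAJₖ ∈ CONV₁` (as `MAJₖ = T_{⌈k/2⌉}ᵏ`). [folklore] -/
theorem maj_isConvGate (k : ℕ) : IsConvGate 1 (GateFn.maj k) :=
  isConvGate_one_of_threshold (t := (k + 1) / 2) fun v =>
    decide_eq_true_iff.trans ⟨fun h => by omega, fun h => by omega⟩

end Literature.Computability.Complexity
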